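import Mathlib
import Literature.NumberTheory.LFunctions.Zhang2022.TypedSection04C
import Literature.NumberTheory.LFunctions.Zhang2022.Section4Statements
import HarnessLib

/-!
# Zhang (2022), §4 Lemma 4.5 — the edges of `Z22:Lem4.5.pf` that complete its kernel proof:
# Case 1 (`Z22:§4.u043`, `Z22:§4.u044`) and the composition through `DedLem45`

Topic `Literature/NumberTheory/LFunctions/Zhang2022` (Landau–Siegel audit tree; verdict-neutral).
Y. Zhang, *Discrete mean estimates and the Landau–Siegel zero*, arXiv:2211.02515v1 (2022)
[Zhang2022LandauSiegel] — **an unrefereed manuscript under adjudication**. DAG node `Z22:Lem4.5.pf`,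
Case 1 (§4 p. 21, tex L1163–L1172):

> Case 1. `1/2 + 𝓛⁻¹ ≤ σ < 1`. By Lemma 4.2 and trivial estimation, `F(1−s,ψ̄)/F(s,ψ) ≪ D^c`. Hence,
> by (4.5), `ℬ(s,ψ) ≪ P^{1/2−σ}`. The result now follows by (4.10).

Theorem-only, no new definitions, no new facts (cell ruling L1 DISCHARGE LEDGER #11: this file is
the COMPLEMENT of L1-t7's `TypedSection04C`, which kernel-checks the Case-2 chain
`Lemma42 → Lemma43 → Eq46 → Eq410 → Step4u044 → Lemma45` (`lemma45_of'`, pending revision) and the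
proof block `dedLem45_holds : Eq410 → Step4u044 → Step4u046Alpha → Lemma45`; Case 1 — the
hypothesis `Step4u044` there — is supplied here). Kernel-checked against L1-t7's typed displays
`Section4.Step4u043`, `Section4.Step4u044` (over `case1Region45`) and L1-t3's `Section4.Eq45`:

* `step4u043_of_lemma41_42 : Lemma41 → Lemma42 → Step4u043` — with `c = 87`, `C = 2C₄₁⁺`: on `Ω₁`,
  Lemma 4.2 (`|FG − 1| ≤ C₄₂𝓛⁻²²⁷ ≤ 1/2` for `𝓛 ≥ 2C₄₂⁺ + 1`) gives `F ≠ 0`, `|F⁻¹| ≤ 2|G| ≤ 2C₄₁𝓛⁷⁹`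
  (Lemma 4.1), and the "trivial estimation" is `|F(1−s,ψ̄)| ≤ Σ_{n≤D⁴}|ν(n)| ≤ D⁸` (`|ν(n)| ≤ τ(n) ≤ n`,
  (3.1)); `𝓛⁷⁹ ≤ D⁷⁹`;
* `step4u044_of_step4u043_eq45 : Step4u043 → Eq45 → Step4u044` — with the implied constant `1`:
  by (4.5) with `ε = 1`, `|Z̃(s)| ≤ 2(Dp²t₀²)^{1/2−σ} ≤ 2(P²)^{1/2−σ} = 2P^{1/2−σ}·P^{1/2−σ}` (`p > P`,
  `Dt₀² ≥ 1`, exponent `≤ 0`) and `P^{1/2−σ} ≤ P^{−1/𝓛} = e^{−𝓛⁸}` (`σ ≥ 1/2 + 𝓛⁻¹`), so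
  `|ℬ(s)| ≤ P^{1/2−σ}·2C e^{c𝓛 − 𝓛⁸} ≤ P^{1/2−σ}` once `𝓛 ≥ 2 + |c| + 2C⁺`;
* `lemma45_of_step4u046Alpha : Lemma41 → Lemma42 → Eq45 → Eq410 → Step4u046Alpha → Lemma45` — Case 1
  plugged into L1-t7's kernel edge `dedLem45_holds : Eq410 → Step4u044 → Step4u046Alpha → Lemma45`;
  the remaining hypothesis `Step4u046Alpha` is Case 2 ("`|𝒜(s,ψ)| ≫ α`").

What is NOT asserted: Lemmas 4.1, 4.2, (4.5), (4.10), Case 2, hence not Lemma 4.5 as such; anything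
about Theorems 1–2 of the source or about Landau–Siegel zeros; nothing here bears on the cell's
verdict on (8.24).

## References

* Y. Zhang, arXiv:2211.02515v1 (2022), §4 Lemma 4.5 (proof, Case 1) p. 21; (3.1); (4.5); (2.6).
  [cite: Zhang2022LandauSiegel, Lemma 4.5 (proof, Case 1) p.21]
-/

noncomputable section

open Complex Real ComplexConjugate Set

namespace Literature.NumberTheory.LFunctions.Zhang2022.Section4

open Literature.NumberTheory.LFunctions.Zhang2022.Skeleton

variable {D : ℕ} [NeZero D] (χ : DirichletCharacter ℂ D) (x : Chr D)

omit [NeZero D] in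
/-- `B ≤ 𝓛` once `D ≥ ⌈exp B⌉` ("`D` sufficiently large", §2 p.4). [cite: Zhang2022LandauSiegel, §2 p. 4] -/
private theorem le_ell_of_ceil_exp_le' {B : ℝ} (hD : ⌈Real.exp B⌉₊ ≤ D) : B ≤ ell D := by
  have h1 : Real.exp B ≤ D := le_trans (Nat.le_ceil _) (by exact_mod_cast hD)
  have hDpos : (0 : ℝ) < D := lt_of_lt_of_le (Real.exp_pos _) h1
  rw [ell, Real.le_log_iff_exp_le hDpos]
  exact h1

/-! ## Tools: "trivial estimation", `Ω₁`-membership, `F⁻¹ ≪ 𝓛⁷⁹`, eventual smallness -/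

/-- If `2·max(C,0) + 1 ≤ 𝓛` then `C·𝓛⁻ᵏ ≤ 1/2` for `k ≥ 1` (an instance of "`D` greater than a
sufficiently large … number", §2 p.4). [cite: Zhang2022LandauSiegel, §2 p.4] -/
private theorem const_mul_inv_pow_le_half {C ℓ : ℝ} {k : ℕ} (hk : k ≠ 0) (hℓ : 2 * max C 0 + 1 ≤ ℓ) :
    C * (ℓ ^ k)⁻¹ ≤ 1 / 2 := by
  have hC := le_max_right C 0
  have hℓ1 : 1 ≤ ℓ := by linarith
  have hpow : ℓ ≤ ℓ ^ k := le_self_pow₀ hℓ1 hk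
  have hpos : 0 < ℓ ^ k := by positivity
  rw [← div_eq_mul_inv, div_le_iff₀ hpos]
  linarith [le_max_left C 0]

omit [NeZero D] in
/-- `|ν(n)| ≤ τ(n) ≤ n` ((3.1), crude form). [cite: Zhang2022LandauSiegel, §3 (3.1)] -/
theorem norm_nu_le_self (n : ℕ) : ‖nu χ n‖ ≤ n := by
  rw [nu, divisorSumChar_apply]
  calc ‖∑ d ∈ n.divisors, χ (d : ZMod D)‖ ≤ ∑ d ∈ n.divisors, ‖χ (d : ZMod D)‖ := norm_sum_le _ _
    _ ≤ ∑ d ∈ n.divisors, (1 : ℝ) := Finset.sum_le_sum fun d _ => χ.norm_le_one _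
    _ = n.divisors.card := by simp
    _ ≤ n := by exact_mod_cast Nat.card_divisors_le_self n

omit [NeZero D] in
/-- **"trivial estimation"** (Lemma 4.5, Case 1): `|F(u,ψ̄)| ≤ D⁸` for `Re u ≥ 0`
(`Σ_{n≤D⁴} |ν(n)| n^{−Re u} ≤ Σ_{n≤D⁴} n ≤ D⁸`). [cite: Zhang2022LandauSiegel, Lemma 4.5 (proof, Case 1) p.21] -/
theorem norm_FpolyBar_le {u : ℂ} (hu : 0 ≤ u.re) : ‖FpolyBar χ x u‖ ≤ (D : ℝ) ^ 8 := by
  unfold FpolyBar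
  have hterm : ∀ n ∈ Finset.Icc 1 (D ^ 4),
      ‖nu χ n * conj (x.ψ (n : ZMod x.p)) * (n : ℂ) ^ (-u)‖ ≤ ((D ^ 4 : ℕ) : ℝ) := by
    intro n hn
    obtain ⟨h1, h2⟩ := Finset.mem_Icc.mp hn
    have hn0 : 0 < n := h1
    have hcpow : ‖(n : ℂ) ^ (-u)‖ ≤ 1 := by
      rw [Complex.norm_natCast_cpow_of_pos hn0]
      exact Real.rpow_le_one_of_one_le_of_nonpos (by exact_mod_cast h1)
        (by simp only [neg_re]; linarith)
    have hψ : ‖conj (x.ψ (n : ZMod x.p))‖ ≤ 1 := by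
      rw [Complex.norm_conj]; exact x.ψ.norm_le_one _
    calc ‖nu χ n * conj (x.ψ (n : ZMod x.p)) * (n : ℂ) ^ (-u)‖
        = ‖nu χ n‖ * ‖conj (x.ψ (n : ZMod x.p))‖ * ‖(n : ℂ) ^ (-u)‖ := by
          rw [norm_mul, norm_mul]
      _ ≤ n * 1 * 1 := by
          gcongr
          exact norm_nu_le_self χ n
      _ = n := by ring
      _ ≤ ((D ^ 4 : ℕ) : ℝ) := by exact_mod_cast h2
  calc ‖∑ n ∈ Finset.Icc 1 (D ^ 4), nu χ n * conj (x.ψ (n : ZMod x.p)) * (n : ℂ) ^ (-u)‖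
      ≤ ∑ n ∈ Finset.Icc 1 (D ^ 4), ‖nu χ n * conj (x.ψ (n : ZMod x.p)) * (n : ℂ) ^ (-u)‖ :=
        norm_sum_le _ _
    _ ≤ ∑ n ∈ Finset.Icc 1 (D ^ 4), ((D ^ 4 : ℕ) : ℝ) := Finset.sum_le_sum hterm
    _ = (D : ℝ) ^ 8 := by
        rw [Finset.sum_const, Nat.card_Icc, nsmul_eq_mul]
        push_cast
        ring

omit [NeZero D] in
/-- Points `σ′ + it` with `1/2 ≤ σ′ < 1`, `|t − 2πt₀| < 𝓛₁ + 2` lie in `Ω₁`, `Ω₂` and the region of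
(4.5)–(4.6) (`D ≥ 3`). [cite: Zhang2022LandauSiegel, Lemma 4.5 (proof) p.21] -/
private theorem seg_mem (hD : 3 ≤ D) {u t : ℝ} (hu : 1 / 2 ≤ u) (hu1 : u < 1)
    (ht : |t - 2 * π * t0 D| < ell1 D + 2) :
    ((u : ℂ) + t * I) ∈ Omega1 D ∧ ((u : ℂ) + t * I) ∈ Omega2 D ∧
      ((u : ℂ) + t * I) ∈ Region45 D := by
  have h1 : 1 < ell D := one_lt_ell hD
  have hpos : 0 < Real.log (ell D) / (100 * ell D) := div_pos (Real.log_pos h1) (by linarith)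
  have hinv : 0 < 1 / ell D := div_pos one_pos (by linarith)
  have hre : ((u : ℂ) + t * I).re = u := by simp
  have him : ((u : ℂ) + t * I).im = t := by simp
  refine ⟨?_, ?_, ?_⟩
  · rw [Omega1, Lemma43.mem_Omega1_iff, hre, him]
    exact ⟨by linarith, by linarith, by linarith⟩
  · rw [Omega2, Lemma43.mem_Omega2_iff, hre, him]
    exact ⟨by linarith, by linarith, by linarith⟩
  · refine ⟨?_, ?_⟩
    · rw [Complex.sub_re, s0_re, hre]
      rw [abs_lt]; constructor <;> linarith
    · rw [Complex.sub_im, s0_im, him]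
      linarith [ht]

omit [NeZero D] in
/-- A point of Case 1's range lies in `Ω₁`, `Ω₂` and the region of (4.5)–(4.6) (`D ≥ 3`).
[cite: Zhang2022LandauSiegel, Lemma 4.5 (proof, Case 1) p.21] -/
theorem mem_of_mem_case1Region45 (hD : 3 ≤ D) {s : ℂ} (hs : s ∈ case1Region45 D) :
    s ∈ Omega1 D ∧ s ∈ Omega2 D ∧ s ∈ Region45 D := by
  obtain ⟨h1, h2, h3⟩ := hs
  have hinv : 0 < (ell D)⁻¹ := inv_pos.mpr (by linarith [one_lt_ell hD])
  have h := seg_mem hD (u := s.re) (t := s.im) (by linarith) h2 h3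
  rwa [Complex.re_add_im] at h

/-- From Lemma 4.2's `|F G − 1| ≤ 1/2`: `F ≠ 0` and `|F⁻¹| ≤ 2|G|` ("`F(s,ψ)⁻¹ ≪ 𝓛⁷⁹` by Lemma 4.1
and 4.2"; the χ-free step is also d12's `Skeleton.inv_norm_le_two_mul_of_norm_mul_sub_one_le`).
[cite: Zhang2022LandauSiegel, §4 p.21 (before (4.10))] -/
private theorem inv_bound_of_norm_mul_sub_one_le {F G : ℂ} (h : ‖F * G - 1‖ ≤ 1 / 2) :
    F ≠ 0 ∧ ‖F⁻¹‖ ≤ 2 * ‖G‖ := by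
  have h1 : 1 / 2 ≤ ‖F‖ * ‖G‖ := by
    have h2 : ‖(1 : ℂ)‖ - ‖F * G‖ ≤ ‖1 - F * G‖ := norm_sub_norm_le _ _
    rw [norm_one, norm_sub_rev, norm_mul] at h2
    linarith
  have hF : F ≠ 0 := by
    intro h0
    rw [h0, norm_zero, zero_mul] at h1
    linarith
  refine ⟨hF, ?_⟩
  have hFpos : 0 < ‖F‖ := norm_pos_iff.mpr hF
  rw [norm_inv, inv_eq_one_div, div_le_iff₀ hFpos]
  nlinarith

omit [NeZero D] in
/-- **"`F(s,ψ)⁻¹ ≪ 𝓛⁷⁹` by Lemma 4.1 and 4.2"** at level `D`: if Lemma 4.2's bound holds on `Ω₁` for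
`ψ ∈ Ψ₁` with `C₄₂𝓛⁻²²⁷ ≤ 1/2` (i.e. `2C₄₂⁺ + 1 ≤ 𝓛`), then at every `z ∈ Ω₁`: `F(z,ψ) ≠ 0` and
`|F(z,ψ)⁻¹| ≤ 2|G(z,ψ)|` (`≤ 2C₄₁𝓛⁷⁹` by Lemma 4.1). [cite: Zhang2022LandauSiegel, §4 p.21 (before (4.10))] -/
theorem fpoly_ne_zero_and_inv_le {C₂ : ℝ}
    (h42 : ∀ x ∈ PsiOne χ, ∀ s ∈ Omega1 D, ‖Fpoly χ x s * Gpoly χ x s - 1‖ ≤ C₂ * (ell D ^ 227)⁻¹)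
    (hℓ : 2 * max C₂ 0 + 1 ≤ ell D) (hx : x ∈ PsiOne χ) {z : ℂ} (hz : z ∈ Omega1 D) :
    Fpoly χ x z ≠ 0 ∧ ‖(Fpoly χ x z)⁻¹‖ ≤ 2 * ‖Gpoly χ x z‖ :=
  inv_bound_of_norm_mul_sub_one_le ((h42 x hx z hz).trans (const_mul_inv_pow_le_half (by norm_num) hℓ))

/-- `𝓛 ≤ D` (`log D ≤ D`; used for "`≪ D^c`" in Lemma 4.5, Case 1). [cite: Zhang2022LandauSiegel, Lemma 4.5 (proof, Case 1) p.21] -/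
theorem ell_le_self (D : ℕ) : ell D ≤ D := by
  rcases Nat.eq_zero_or_pos D with h | h
  · subst h; simp [ell]
  · have hD : (0 : ℝ) < D := by exact_mod_cast h
    linarith [Real.log_le_sub_one_of_pos hD, show ell D = Real.log D from rfl]

omit [NeZero D] in
/-- `P^{1/2−σ} ≤ P^{−1/𝓛} = e^{−𝓛⁸}` for `σ ≥ 1/2 + 𝓛⁻¹` (`P = e^{𝓛⁹}`, `D ≥ 3`).
[cite: Zhang2022LandauSiegel, Lemma 4.5 (proof, Case 1) p.21] -/
theorem bigP_rpow_le_exp_neg (hD : 3 ≤ D) {σ : ℝ} (hσ : 1 / 2 + (ell D)⁻¹ ≤ σ) :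
    bigP D ^ (1 / 2 - σ) ≤ Real.exp (-ell D ^ 8) := by
  have hℓ : 1 < ell D := one_lt_ell hD
  have hℓ0 : 0 < ell D := by linarith
  have hP1 : 1 ≤ bigP D := by rw [bigP]; exact Real.one_le_exp (by positivity)
  calc bigP D ^ (1 / 2 - σ) ≤ bigP D ^ (-(ell D)⁻¹) :=
        Real.rpow_le_rpow_of_exponent_le hP1 (by linarith)
    _ = Real.exp (-ell D ^ 8) := by
        rw [bigP, ← Real.exp_mul]
        congr 1
        field_simp

omit [NeZero D] in
/-- Eventual smallness for Case 1: for `𝓛 ≥ 2 + |c| + 2C⁺`, `2C⁺·exp(c𝓛 − 𝓛⁸) ≤ 1` ("`D`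
sufficiently large", §2 p.4, as consumed by Lemma 4.5 Case 1). [cite: Zhang2022LandauSiegel, Lemma 4.5 (proof, Case 1) p.21] -/
theorem case1_small {c C ℓ : ℝ} (hℓ : 2 + |c| + 2 * max C 0 ≤ ℓ) :
    2 * max C 0 * Real.exp (c * ℓ - ℓ ^ 8) ≤ 1 := by
  have hC : 0 ≤ max C 0 := le_max_right _ _
  have hc : 0 ≤ |c| := abs_nonneg _
  have hℓ1 : 1 ≤ ℓ := by linarith
  have hℓ2 : ℓ ^ 2 ≤ ℓ ^ 8 := pow_le_pow_right₀ hℓ1 (by norm_num)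
  have hcl : c * ℓ ≤ |c| * ℓ := mul_le_mul_of_nonneg_right (le_abs_self c) (by linarith)
  have hexp : Real.exp (c * ℓ - ℓ ^ 8) ≤ Real.exp (-ℓ) := Real.exp_le_exp.mpr (by nlinarith)
  have hexp2 : Real.exp (-ℓ) ≤ (1 + ℓ)⁻¹ := by
    rw [Real.exp_neg]
    exact inv_anti₀ (by linarith) (by linarith [Real.add_one_le_exp ℓ])
  have h3 : 2 * max C 0 * (1 + ℓ)⁻¹ ≤ 1 := by
    rw [← div_eq_mul_inv, div_le_one (by linarith)]; linarith
  calc 2 * max C 0 * Real.exp (c * ℓ - ℓ ^ 8) ≤ 2 * max C 0 * (1 + ℓ)⁻¹ := by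
        gcongr; exact hexp.trans hexp2
    _ ≤ 1 := h3

/-! ## `Z22:§4.u043` and `Z22:§4.u044` -/

/-- **`Z22:§4.u043` from Lemmas 4.1–4.2**: for `ψ ∈ Ψ₁`, `s` in the region of Lemma 4.5 (so
`s ∈ Ω₁`): `|F(1−s,ψ̄)/F(s,ψ)| ≤ D⁸ · 2|G(s,ψ)| ≤ 2C₄₁D⁸𝓛⁷⁹ ≤ 2C₄₁⁺D⁸⁷` ("By Lemma 4.2 and trivial
estimation, `F(1−s,ψ̄)/F(s,ψ) ≪ D^c`", with `c = 87`).
[cite: Zhang2022LandauSiegel, Lemma 4.5 (proof, Case 1) p.21] -/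
theorem step4u043_of_lemma41_42 (h41 : Lemma41) (h42 : Lemma42) : Step4u043 := by
  obtain ⟨C₁, h41⟩ := h41
  obtain ⟨C₂, h42⟩ := h42
  obtain ⟨D₀, h⟩ := h41.and h42
  refine ⟨87, 2 * max C₁ 0, max D₀ (max 3 ⌈Real.exp (2 * max C₂ 0 + 1)⌉₊),
    fun D _ χ hD hq hp x hx s hs => ?_⟩
  have hD₀ : D₀ ≤ D := le_trans (le_max_left _ _) hD
  have hD3 : 3 ≤ D := le_trans (le_trans (le_max_left _ _) (le_max_right _ _)) hD
  have hDe : ⌈Real.exp (2 * max C₂ 0 + 1)⌉₊ ≤ D :=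
    le_trans (le_trans (le_max_right _ _) (le_max_right _ _)) hD
  have hℓ := le_ell_of_ceil_exp_le' hDe
  obtain ⟨e41, e42⟩ := h D χ hD₀ hq hp
  have hΩ1 : s ∈ Omega1 D := (mem_of_mem_case1Region45 hD3 hs).1
  obtain ⟨hF0, hFinv⟩ := fpoly_ne_zero_and_inv_le χ x e42 hℓ hx hΩ1
  have hℓ0 : 0 ≤ ell D := by linarith [one_lt_ell hD3]
  have hG : ‖Gpoly χ x s‖ ≤ max C₁ 0 * ell D ^ 79 :=
    calc ‖Gpoly χ x s‖ ≤ ‖Fpoly χ x s‖ + ‖Gpoly χ x s‖ := le_add_of_nonneg_left (norm_nonneg _)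
      _ ≤ C₁ * ell D ^ 79 := e41 x hx s hΩ1
      _ ≤ max C₁ 0 * ell D ^ 79 :=
        mul_le_mul_of_nonneg_right (le_max_left _ _) (pow_nonneg hℓ0 79)
  have hre : 0 ≤ (1 - s).re := by
    have := hs.2.1
    simp only [Complex.sub_re, Complex.one_re]; linarith
  have hFb : ‖FpolyBar χ x (1 - s)‖ ≤ (D : ℝ) ^ 8 := norm_FpolyBar_le χ x hre
  have hℓD : ell D ^ 79 ≤ (D : ℝ) ^ 79 := pow_le_pow_left₀ hℓ0 (ell_le_self D) 79
  have hD87 : (D : ℝ) ^ (87 : ℝ) = (D : ℝ) ^ 8 * (D : ℝ) ^ 79 := by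
    rw [show (87 : ℝ) = ((87 : ℕ) : ℝ) by norm_num, Real.rpow_natCast]; ring
  calc ‖FpolyBar χ x (1 - s) / Fpoly χ x s‖ = ‖FpolyBar χ x (1 - s)‖ * ‖(Fpoly χ x s)⁻¹‖ := by
        rw [div_eq_mul_inv, norm_mul]
    _ ≤ (D : ℝ) ^ 8 * (2 * ‖Gpoly χ x s‖) := by gcongr
    _ ≤ (D : ℝ) ^ 8 * (2 * (max C₁ 0 * ell D ^ 79)) := by gcongr
    _ = 2 * max C₁ 0 * ((D : ℝ) ^ 8 * ell D ^ 79) := by ring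
    _ ≤ 2 * max C₁ 0 * ((D : ℝ) ^ 8 * (D : ℝ) ^ 79) := by gcongr
    _ = 2 * max C₁ 0 * (D : ℝ) ^ (87 : ℝ) := by rw [hD87]

/-- **`Z22:§4.u044` from `Z22:§4.u043` and (4.5)** ("Hence, by (4.5), `ℬ(s,ψ) ≪ P^{1/2−σ}`", with the
implied constant `1`): `|Z̃(s)| ≤ 2(Dp²t₀²)^{1/2−σ} ≤ 2P^{1−2σ} = 2P^{1/2−σ}·P^{1/2−σ} ≤ 2P^{1/2−σ}e^{−𝓛⁸}`
(`p > P`, `σ ≥ 1/2 + 𝓛⁻¹`), and `2C D^c e^{−𝓛⁸} = 2C e^{c𝓛 − 𝓛⁸} ≤ 1` for large `D`.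
[cite: Zhang2022LandauSiegel, Lemma 4.5 (proof, Case 1) p.21] -/
theorem step4u044_of_step4u043_eq45 (h43 : Step4u043) (h45 : Eq45) : Step4u044 := by
  obtain ⟨c, C, h43⟩ := h43
  obtain ⟨D₀, h⟩ := h43.and (h45 1 one_pos)
  refine ⟨1, max D₀ (max 3 ⌈Real.exp (2 + |c| + 2 * max C 0)⌉₊), fun D _ χ hD hq hp x hx s hs => ?_⟩
  have hD₀ : D₀ ≤ D := le_trans (le_max_left _ _) hD
  have hD3 : 3 ≤ D := le_trans (le_trans (le_max_left _ _) (le_max_right _ _)) hD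
  have hDe : ⌈Real.exp (2 + |c| + 2 * max C 0)⌉₊ ≤ D :=
    le_trans (le_trans (le_max_right _ _) (le_max_right _ _)) hD
  have hsmall := case1_small (le_ell_of_ceil_exp_le' hDe)
  obtain ⟨e43, e45⟩ := h D χ hD₀ hq hp
  have hR45 : s ∈ Region45 D := (mem_of_mem_case1Region45 hD3 hs).2.2
  have hℓ : 1 < ell D := one_lt_ell hD3
  -- the quotient `F(1−s,ψ̄)/F(s,ψ) ≪ D^c`
  have hq1 : ‖FpolyBar χ x (1 - s) / Fpoly χ x s‖ ≤ max C 0 * (D : ℝ) ^ c :=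
    (e43 x hx s hs).trans (by gcongr; exact le_max_left _ _)
  have hDc : (D : ℝ) ^ c = Real.exp (c * ell D) := by
    rw [ell, Real.rpow_def_of_pos (by exact_mod_cast (show 0 < D by omega)), mul_comm]
  -- `|Z̃(s)| ≤ 2 M^{1/2−σ}`, `M = Dp²t₀²`
  set e : ℝ := 1 / 2 - s.re with he
  set M : ℝ := (D : ℝ) * (x.p : ℝ) ^ 2 * t0 D ^ 2 with hM
  have he0 : e ≤ 0 := by
    have := hs.1
    have : 0 < (ell D)⁻¹ := inv_pos.mpr (by linarith)
    rw [he]; linarith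
  have hP0 : 0 < bigP D := Real.exp_pos _
  have hPp : bigP D < x.p := by
    have hm := x.mem
    rw [primeWindow, Finset.mem_filter, Finset.mem_Ioo] at hm
    exact (Nat.floor_lt hP0.le).mp hm.1.1
  have ht0 : 1 ≤ t0 D := one_le_pow₀ hℓ.le
  have hD1 : (1 : ℝ) ≤ D := by exact_mod_cast (show 1 ≤ D by omega)
  have hPM : bigP D ^ 2 ≤ M := by
    rw [hM]
    have h1 : bigP D ^ 2 ≤ (x.p : ℝ) ^ 2 := by gcongr
    have h2 : (x.p : ℝ) ^ 2 ≤ (D : ℝ) * (x.p : ℝ) ^ 2 * t0 D ^ 2 := by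
      have ht2 : 1 ≤ t0 D ^ 2 := one_le_pow₀ ht0
      calc (x.p : ℝ) ^ 2 = 1 * (x.p : ℝ) ^ 2 * 1 := by ring
        _ ≤ (D : ℝ) * (x.p : ℝ) ^ 2 * t0 D ^ 2 := by gcongr
    exact h1.trans h2
  have hP2pos : 0 < bigP D ^ 2 := by positivity
  have hZ : ‖tildeZW χ x s‖ ≤ 2 * M ^ e := by
    have h1 := e45 x s hR45
    rw [← hM, ← he, one_mul] at h1
    have hMe : 0 ≤ M ^ e := Real.rpow_nonneg (hP2pos.le.trans hPM) _
    have := (abs_le.mp h1).2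
    linarith
  have hMe : M ^ e ≤ bigP D ^ e * Real.exp (-ell D ^ 8) := by
    calc M ^ e ≤ (bigP D ^ 2) ^ e := Real.rpow_le_rpow_of_nonpos hP2pos hPM he0
      _ = bigP D ^ e * bigP D ^ e := by
          rw [← Real.rpow_natCast, ← Real.rpow_mul hP0.le, ← Real.rpow_add hP0]
          congr 1; push_cast; ring
      _ ≤ bigP D ^ e * Real.exp (-ell D ^ 8) := by
          gcongr; exact bigP_rpow_le_exp_neg hD3 hs.1
  -- assemble
  have hPe : 0 ≤ bigP D ^ e := Real.rpow_nonneg hP0.le _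
  calc ‖calB χ x s‖ = ‖tildeZW χ x s‖ * ‖FpolyBar χ x (1 - s) / Fpoly χ x s‖ := by
        rw [calB, mul_div_assoc, norm_mul]
    _ ≤ (2 * M ^ e) * (max C 0 * (D : ℝ) ^ c) := by gcongr
    _ ≤ (2 * (bigP D ^ e * Real.exp (-ell D ^ 8))) * (max C 0 * (D : ℝ) ^ c) := by gcongr
    _ = bigP D ^ e * (2 * max C 0 * Real.exp (c * ell D - ell D ^ 8)) := by
        rw [hDc, sub_eq_add_neg, Real.exp_add]; ring
    _ ≤ bigP D ^ e * 1 := by gcongr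
    _ = 1 * bigP D ^ (1 / 2 - s.re) := by rw [he]; ring

/-! ## Case 1 plugged into the proof block `DedLem45` -/

/-- **Lemma 4.5 modulo Case 2**: Lemma 4.1, Lemma 4.2, (4.5), (4.10) and Case 2's "`|𝒜(s,ψ)| ≫ α`"
(`Step4u046Alpha`) give Lemma 4.5, through L1-t7's edge `dedLem45_holds` with Case 1 (`Step4u044`)
supplied by this file. [cite: Zhang2022LandauSiegel, Lemma 4.5 (proof) pp.21–22] -/
theorem lemma45_of_step4u046Alpha (h41 : Lemma41) (h42 : Lemma42) (h45 : Eq45) (h410 : Eq410)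
    (h46a : Step4u046Alpha) : Lemma45 :=
  dedLem45_holds h410 (step4u044_of_step4u043_eq45 (step4u043_of_lemma41_42 h41 h42) h45) h46a

end Literature.NumberTheory.LFunctions.Zhang2022.Section4
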